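import Summits.CriticalPhenomena.PercolationContinuityZ3.Theorems.PercNearOneGluingNearOneGluingS2OfS2M
import Summits.CriticalPhenomena.PercolationContinuityZ3.Theorems.PercNearOneGluingNearOneGluingU1M

/-!
# Crux `PercNearOneGluing.NearOneGluing` (stmt-CriticalPhenomena-4574), line `SketchR2I5` —
# Lemma M for the sharp exchange slack S2_M (stub `stub_s2M`): `Cov(1_J̃, 1{z↮b} | y↮z) ≥ 0`

Lead prover-line-stmt-CriticalPhenomena-4574-c7 (cycle 7, wave 4, stub-worker W6).  Lands
`--supports stmt-CriticalPhenomena-4574`; no definitions, no named facts.  Companion of `…S2MPieces`.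

## Content

Finite weighted graph on `Fin n`, `μ = prodBernoulli w`, `{u ↔ v} = openConn u v`, `C_s(ω) = openEdgeCluster ω s`;
`y ≠ z`, `o, b, x` arbitrary.  Notation: `D := {y ↮ z}`, `N := {x↮y} ∩ {x↮z} ∩ {y↮z}`, `J := {o↔x} ∪ {o↔y}`,
`J̃ := {o↔y} ∪ ({o↔x} ∩ {x↮z})`, `R := {o↮z} ∩ {y↮z}`, `θ_M := μ({o↔x} ∩ N)/μ(N)`.
The registered sharp residual `stub_s2M` is `Cov_D(1{o↔y} − θ_M·1{x↔y}, 1{z↮b}) ≥ 0`; with the exact decomposition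
`1{o↔y} − θ_M·1{x↔y} = (1_J̃ + θ_M·1{x↔z} − θ_M) − 1_N·(1{o↔x} − θ_M)` on `D` (`E_D[1_N(1{o↔x} − θ_M)] = 0`), its
Harris part is **Lemma M** (`s2Mp_lemmaM`):

  `μ(J̃ ∩ D)·μ({z↮b} ∩ D) ≤ μ(D)·μ(J̃ ∩ {z↮b} ∩ D)`.

Proof (the "M-trick" of the line, crux NOTES §H.3, in set form): on `D`, `J̃ = J ∩ R` (an `o`–`y` or `o`–`x`–…
connection under `J̃ ∩ D` never reaches `z`).  By van den Berg–Häggström–Kahn Thm. 1.4 for the clusters of the SET `{o,y}`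
and of `z` given `R = {{o,y} ↮ z}` (tree theorem `stub_bhkSets` (ii), hub form), with `f = 1_J` (read off `C_o ∪ C_y`,
increasing) and `g = 1{z↔b}` (read off `C_z`): `μ(R)·μ(R ∩ J ∩ {z↔b}) ≤ μ(R ∩ J)·μ(R ∩ {z↔b})` (`s2Mp_bhk14_oy_z`).
By BHK Thm. 1.3 for `C_z` given `{z↮y}` with `1{z↔o}`, `1{z↔b}` (`stub_bhkSets` (i)):
`μ(D ∩ {z↔o})·μ(D ∩ {z↔b}) ≤ μ(D)·μ(D ∩ {z↔o} ∩ {z↔b})`, i.e. `μ(R)·μ(D ∩ {z↔b}) ≥ μ(D)·μ(R ∩ {z↔b})`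
(`s2Mp_bhk13_z`).  Hence `μ(R)·[μ(R∩J)·μ({z↮b}∩D) − μ(D)·μ(R∩J∩{z↮b})] = μ(R)·[μ(R∩J)μ(D∩{z↔b}) − μ(D)μ(R∩J∩{z↔b})]
≥ μ(R∩J)·[μ(R)μ(D∩{z↔b}) − μ(D)μ(R∩{z↔b})] ≥ 0`; if `μ(R) = 0` both sides vanish, and if `o = z` then `J̃ ∩ D = ∅`.
[cite: VandenbergHaggstromKahn2005, Thm. 1.3 (p. 6), Thm. 1.4 (p. 7)] [cite: KozmaNitzan2024, Question 7 (p. 36)]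
-/

namespace Summit.CriticalPhenomena.PercolationContinuityZ3.Theorems

open MeasureTheory Set Literature.Probability.LatticeModels Literature.Probability.Percolation
open scoped Classical BigOperators
open Q7ThreeCut

noncomputable section

variable {n : ℕ}

/-! ### BHK for the clusters of `{o,y}` and `z`, and for `C_z` given `{z↮y}` -/

/-- **BHK Thm. 1.4 for the clusters of `{o, y}` and of `z` given `R = {o↮z} ∩ {y↮z}`**, with `f = 1_J`,
`J = {o↔x} ∪ {o↔y}` (read off `C_o ∪ C_y`, increasing) and `g = 1{z↔b}` (read off `C_z`):
`μ(R)·μ(R ∩ (J ∩ {z↔b})) ≤ μ(R ∩ J)·μ(R ∩ {z↔b})` (tree theorem `stub_bhkSets`, part (ii)).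
[cite: VandenbergHaggstromKahn2005, Thm. 1.4 (p. 7)] -/
theorem s2Mp_bhk14_oy_z (w : Sym2 (Fin n) → unitInterval) (o b x y z : Fin n) (hoz : o ≠ z) (hyz : y ≠ z) :
    (prodBernoulli w).real ((openConn o z)ᶜ ∩ (openConn y z)ᶜ) *
        (prodBernoulli w).real (((openConn o z)ᶜ ∩ (openConn y z)ᶜ) ∩ ((openConn o x ∪ openConn o y) ∩ openConn z b)) ≤
      (prodBernoulli w).real (((openConn o z)ᶜ ∩ (openConn y z)ᶜ) ∩ (openConn o x ∪ openConn o y)) *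
        (prodBernoulli w).real (((openConn o z)ᶜ ∩ (openConn y z)ᶜ) ∩ openConn z b) := by
  set μ := prodBernoulli w with hμ
  set R : Set (BondConfig (Fin n)) := (openConn o z)ᶜ ∩ (openConn y z)ᶜ with hR
  obtain ⟨-, h14⟩ := stub_bhkSets
  set F : Set (Sym2 (Fin n)) → ℝ := (openConn o x ∪ openConn o y : Set (BondConfig (Fin n))).indicator 1 with hF
  set G : Set (Sym2 (Fin n)) → ℝ := (openConn z b : Set (BondConfig (Fin n))).indicator 1 with hG
  have hFm : Monotone F :=
    monotone_indicator_of_isUpperSet ((isUpperSet_openConn o x).union (isUpperSet_openConn o y))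
  have hGm : Monotone G := monotone_indicator_of_isUpperSet (isUpperSet_openConn z b)
  -- the conditioning set `{o, y} ↮ {z}` is `R`
  have hD : {ω : BondConfig (Fin n) | ∀ s ∈ ({o, y} : Finset (Fin n)), ∀ t ∈ ({z} : Finset (Fin n)),
      ¬ (openGraph ω).Reachable s t} = R := by
    ext ω
    simp only [mem_setOf_eq, Finset.mem_insert, Finset.mem_singleton, forall_eq_or_imp, forall_eq, hR,
      mem_inter_iff, mem_compl_iff]
    rfl
  -- the clusters
  have hCoy : ∀ ω : BondConfig (Fin n), (⋃ s ∈ ({o, y} : Finset (Fin n)), openEdgeCluster ω s) =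
      openEdgeCluster ω o ∪ openEdgeCluster ω y := by
    intro ω
    rw [Finset.set_biUnion_insert, Finset.set_biUnion_singleton]
  have hCz : ∀ ω : BondConfig (Fin n), (⋃ s ∈ ({z} : Finset (Fin n)), openEdgeCluster ω s) =
      openEdgeCluster ω z := fun ω => Finset.set_biUnion_singleton z _
  have hCω : ∀ ω : BondConfig (Fin n), openEdgeCluster ω o ∪ openEdgeCluster ω y ⊆ ω := fun ω =>
    union_subset (openEdgeCluster_subset ω o) (openEdgeCluster_subset ω y)
  -- pointwise identification of the integrands
  have eF : ∀ ω : BondConfig (Fin n), F (openEdgeCluster ω o ∪ openEdgeCluster ω y) =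
      (openConn o x ∪ openConn o y : Set (BondConfig (Fin n))).indicator 1 ω := by
    intro ω
    have h1 : openEdgeCluster ω o ∪ openEdgeCluster ω y ∈ (openConn o x : Set (BondConfig (Fin n))) ↔
        ω ∈ (openConn o x : Set (BondConfig (Fin n))) :=
      mem_openConn_iff_of_cluster_subset subset_union_left (hCω ω)
    have h2 : openEdgeCluster ω o ∪ openEdgeCluster ω y ∈ (openConn o y : Set (BondConfig (Fin n))) ↔
        ω ∈ (openConn o y : Set (BondConfig (Fin n))) :=
      mem_openConn_iff_of_cluster_subset subset_union_left (hCω ω)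
    rw [hF]
    exact u1M_indicator_one_congr (or_congr h1 h2)
  have eG : ∀ ω : BondConfig (Fin n), G (openEdgeCluster ω z) =
      (openConn z b : Set (BondConfig (Fin n))).indicator 1 ω := fun ω =>
    indicator_openConn_of_cluster_subset subset_rfl (openEdgeCluster_subset ω z)
  have eFG : ∀ ω : BondConfig (Fin n),
      F (openEdgeCluster ω o ∪ openEdgeCluster ω y) * G (openEdgeCluster ω z) =
        ((openConn o x ∪ openConn o y) ∩ openConn z b : Set (BondConfig (Fin n))).indicator 1 ω := by
    intro ω
    rw [eF, eG]
    exact (congrFun (inter_indicator_one (s := (openConn o x ∪ openConn o y : Set (BondConfig (Fin n))))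
      (t := openConn z b) (M₀ := ℝ)) ω).symm
  have key := h14 n w {o, y} {z} F G hFm hGm (by
    simp only [Finset.disjoint_insert_left, Finset.mem_singleton, Finset.disjoint_singleton_left]
    exact ⟨hoz, hyz⟩)
  simp only [hD, hCoy, hCz] at key
  simp only [eFG] at key
  simp only [eF, eG, setIntegral_indicator_one_eq] at key
  exact key

/-- **BHK Thm. 1.3 for the cluster of `z` given `{z ↮ y}`**, with `f = 1{z↔o}` and `g = 1{z↔b}` (both increasing in `C_z`):
`μ(D ∩ {z↔o})·μ(D ∩ {z↔b}) ≤ μ(D)·μ(D ∩ ({z↔o} ∩ {z↔b}))`, `D = {y↮z}` (tree theorem `stub_bhkSets`, part (i)).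
[cite: VandenbergHaggstromKahn2005, Thm. 1.3 (p. 6)] -/
theorem s2Mp_bhk13_z (w : Sym2 (Fin n) → unitInterval) (o b y z : Fin n) (hyz : y ≠ z) :
    (prodBernoulli w).real ((openConn y z)ᶜ ∩ openConn z o) * (prodBernoulli w).real ((openConn y z)ᶜ ∩ openConn z b) ≤
      (prodBernoulli w).real (openConn y z)ᶜ * (prodBernoulli w).real ((openConn y z)ᶜ ∩ (openConn z o ∩ openConn z b)) := by
  set μ := prodBernoulli w with hμ
  obtain ⟨h13, -⟩ := stub_bhkSets
  set F : Set (Sym2 (Fin n)) → ℝ := (openConn z o : Set (BondConfig (Fin n))).indicator 1 with hF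
  set G : Set (Sym2 (Fin n)) → ℝ := (openConn z b : Set (BondConfig (Fin n))).indicator 1 with hG
  have hFm : Monotone F := monotone_indicator_of_isUpperSet (isUpperSet_openConn z o)
  have hGm : Monotone G := monotone_indicator_of_isUpperSet (isUpperSet_openConn z b)
  have hD : {ω : BondConfig (Fin n) | ∀ s ∈ ({z} : Finset (Fin n)), ∀ t ∈ ({y} : Set (Fin n)),
      ¬ (openGraph ω).Reachable s t} = (openConn y z)ᶜ := by
    ext ω
    simp only [mem_setOf_eq, Finset.mem_singleton, forall_eq, mem_singleton_iff, mem_compl_iff,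
      ← knThm2_openConn_comm z y]
    rfl
  have hCz : ∀ ω : BondConfig (Fin n), (⋃ s ∈ ({z} : Finset (Fin n)), openEdgeCluster ω s) =
      openEdgeCluster ω z := fun ω => Finset.set_biUnion_singleton z _
  have eF : ∀ ω : BondConfig (Fin n), F (openEdgeCluster ω z) =
      (openConn z o : Set (BondConfig (Fin n))).indicator 1 ω := fun ω =>
    indicator_openConn_of_cluster_subset subset_rfl (openEdgeCluster_subset ω z)
  have eG : ∀ ω : BondConfig (Fin n), G (openEdgeCluster ω z) =
      (openConn z b : Set (BondConfig (Fin n))).indicator 1 ω := fun ω =>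
    indicator_openConn_of_cluster_subset subset_rfl (openEdgeCluster_subset ω z)
  have eFG : ∀ ω : BondConfig (Fin n), F (openEdgeCluster ω z) * G (openEdgeCluster ω z) =
      (openConn z o ∩ openConn z b : Set (BondConfig (Fin n))).indicator 1 ω := by
    intro ω
    rw [eF, eG]
    exact (congrFun (inter_indicator_one (s := (openConn z o : Set (BondConfig (Fin n))))
      (t := openConn z b) (M₀ := ℝ)) ω).symm
  have key := h13 n w {z} ({y} : Set (Fin n)) F G hFm hGm (by
    intro s hs
    rw [mem_singleton_iff]
    simp only [Finset.mem_singleton] at hs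
    rw [hs]
    exact fun h => hyz h.symm)
  simp only [hD, hCz] at key
  simp only [eFG] at key
  simp only [eF, eG, setIntegral_indicator_one_eq] at key
  exact key

/-- **Lemma M.**  With `J̃ := {o↔y} ∪ ({o↔x} ∩ {x↮z})` and `D = {y↮z}`:
`μ(J̃ ∩ D)·μ({z↮b} ∩ D) ≤ μ(D)·μ(J̃ ∩ {z↮b} ∩ D)`, i.e. `Cov(1_J̃, 1{z↮b} | y↮z) ≥ 0` — the Harris part of the
exchange decomposition `1{o↔y} − θ_M·1{x↔y} = (1_J̃ + θ_M·1{x↔z} − θ_M) − 1_N·(1{o↔x} − θ_M)` of S2_M.  Proof: on `D`,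
`J̃ = J ∩ R` with `J = {o↔x} ∪ {o↔y}`, `R = {o↮z} ∩ {y↮z}`; by `s2Mp_bhk14_oy_z` (`C_{{o,y}}` and `C_z` repel given `R`)
`μ(R)·μ(J ∩ R ∩ {z↔b}) ≤ μ(J ∩ R)·μ(R ∩ {z↔b})`, and by `s2Mp_bhk13_z` (`1{z↔o}`, `1{z↔b}` attract given `D`)
`μ(R)·μ({z↔b} ∩ D) ≥ μ(D)·μ(R ∩ {z↔b})`; hence `μ(R) × [μ(J∩R)μ({z↔b}∩D) − μ(D)μ(J∩R∩{z↔b})] ≥ 0`.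
[cite: VandenbergHaggstromKahn2005, Thm. 1.3 (p. 6), Thm. 1.4 (p. 7)] -/
theorem s2Mp_lemmaM (w : Sym2 (Fin n) → unitInterval) (o b x y z : Fin n) (hyz : y ≠ z) :
    (prodBernoulli w).real ((openConn o y ∪ (openConn o x ∩ (openConn x z)ᶜ)) ∩ (openConn y z)ᶜ) *
        (prodBernoulli w).real ((openConn z b)ᶜ ∩ (openConn y z)ᶜ) ≤
      (prodBernoulli w).real (openConn y z)ᶜ *
        (prodBernoulli w).real ((openConn o y ∪ (openConn o x ∩ (openConn x z)ᶜ)) ∩ (openConn z b)ᶜ ∩ (openConn y z)ᶜ) := by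
  set μ := prodBernoulli w with hμ
  have hmeas : ∀ s : Set (BondConfig (Fin n)), MeasurableSet s := fun _ => MeasurableSet.of_discrete
  by_cases hoz : o = z
  · -- degenerate case `o = z`: `J̃ ∩ D = ∅`
    subst hoz
    have e0 : ((openConn o y ∪ (openConn o x ∩ (openConn x o)ᶜ)) ∩ (openConn y o)ᶜ : Set (BondConfig (Fin n))) = ∅ := by
      ext ω
      simp only [mem_inter_iff, mem_union, mem_compl_iff, mem_empty_iff_false, iff_false, not_and, not_not]
      rintro (hoy | ⟨hox, hxo⟩)
      · exact conn_symm hoy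
      · exact absurd (conn_symm hox) hxo
    have e0' : ((openConn o y ∪ (openConn o x ∩ (openConn x o)ᶜ)) ∩ (openConn o b)ᶜ ∩ (openConn y o)ᶜ :
        Set (BondConfig (Fin n))) = ∅ := by
      rw [inter_assoc, inter_comm (openConn o b)ᶜ, ← inter_assoc, e0, empty_inter]
    rw [e0, e0']
    simp
  · set R : Set (BondConfig (Fin n)) := (openConn o z)ᶜ ∩ (openConn y z)ᶜ with hR
    have h14 := s2Mp_bhk14_oy_z w o b x y z hoz hyz
    have h13 := s2Mp_bhk13_z w o b y z hyz
    -- `J̃ ∩ D = R ∩ J`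
    have e1 : ((openConn o y ∪ (openConn o x ∩ (openConn x z)ᶜ)) ∩ (openConn y z)ᶜ : Set (BondConfig (Fin n))) =
        R ∩ (openConn o x ∪ openConn o y) := by
      ext ω
      simp only [hR, mem_inter_iff, mem_union, mem_compl_iff]
      constructor
      · rintro ⟨hJ | ⟨hox, hxz'⟩, hyz'⟩
        · exact ⟨⟨fun hoz' => hyz' (conn_trans (conn_symm hJ) hoz'), hyz'⟩, Or.inr hJ⟩
        · exact ⟨⟨fun hoz' => hxz' (conn_trans (conn_symm hox) hoz'), hyz'⟩, Or.inl hox⟩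
      · rintro ⟨⟨hoz', hyz'⟩, hox | hoy⟩
        · exact ⟨Or.inr ⟨hox, fun hxz' => hoz' (conn_trans hox hxz')⟩, hyz'⟩
        · exact ⟨Or.inl hoy, hyz'⟩
    have e2 : ((openConn o y ∪ (openConn o x ∩ (openConn x z)ᶜ)) ∩ (openConn z b)ᶜ ∩ (openConn y z)ᶜ :
        Set (BondConfig (Fin n))) = (R ∩ (openConn o x ∪ openConn o y)) \ openConn z b := by
      rw [← e1]
      ext ω; simp only [mem_inter_iff, mem_sdiff, mem_compl_iff]; tauto
    -- measure bookkeeping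
    have m1 : μ.real ((R ∩ (openConn o x ∪ openConn o y)) ∩ openConn z b) +
        μ.real ((R ∩ (openConn o x ∪ openConn o y)) \ openConn z b) = μ.real (R ∩ (openConn o x ∪ openConn o y)) :=
      measureReal_inter_add_sdiff (μ := μ) (hmeas _)
    have e3 : (R ∩ (openConn o x ∪ openConn o y)) ∩ openConn z b = R ∩ ((openConn o x ∪ openConn o y) ∩ openConn z b) :=
      inter_assoc _ _ _
    have m2 : μ.real (((openConn y z)ᶜ : Set (BondConfig (Fin n))) ∩ openConn z b) +
        μ.real (((openConn y z)ᶜ : Set (BondConfig (Fin n))) \ openConn z b) = μ.real ((openConn y z)ᶜ : Set (BondConfig (Fin n))) :=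
      measureReal_inter_add_sdiff (μ := μ) (hmeas _)
    have e4 : ((openConn y z)ᶜ : Set (BondConfig (Fin n))) \ openConn z b = (openConn z b)ᶜ ∩ (openConn y z)ᶜ := by
      ext ω; simp only [mem_sdiff, mem_compl_iff, mem_inter_iff]; tauto
    -- `R = D ∖ {z↔o}`, `R ∩ {z↔b} = (D ∩ {z↔b}) ∖ {z↔o}`
    have m3 : μ.real (((openConn y z)ᶜ : Set (BondConfig (Fin n))) ∩ openConn z o) +
        μ.real (((openConn y z)ᶜ : Set (BondConfig (Fin n))) \ openConn z o) = μ.real ((openConn y z)ᶜ : Set (BondConfig (Fin n))) :=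
      measureReal_inter_add_sdiff (μ := μ) (hmeas _)
    have e5 : ((openConn y z)ᶜ : Set (BondConfig (Fin n))) \ openConn z o = R := by
      ext ω; simp only [hR, mem_sdiff, mem_compl_iff, mem_inter_iff, knThm2_openConn_comm z o]; tauto
    have m4 : μ.real ((((openConn y z)ᶜ : Set (BondConfig (Fin n))) ∩ openConn z b) ∩ openConn z o) +
        μ.real ((((openConn y z)ᶜ : Set (BondConfig (Fin n))) ∩ openConn z b) \ openConn z o) =
          μ.real (((openConn y z)ᶜ : Set (BondConfig (Fin n))) ∩ openConn z b) :=
      measureReal_inter_add_sdiff (μ := μ) (hmeas _)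
    have e6 : (((openConn y z)ᶜ : Set (BondConfig (Fin n))) ∩ openConn z b) ∩ openConn z o =
        (openConn y z)ᶜ ∩ (openConn z o ∩ openConn z b) := by
      ext ω; simp only [mem_inter_iff, mem_compl_iff]; tauto
    have e7 : (((openConn y z)ᶜ : Set (BondConfig (Fin n))) ∩ openConn z b) \ openConn z o = R ∩ openConn z b := by
      ext ω; simp only [hR, mem_sdiff, mem_inter_iff, mem_compl_iff, knThm2_openConn_comm z o]; tauto
    rw [e3] at m1
    rw [e4] at m2
    rw [e5] at m3
    rw [e6, e7] at m4
    rw [e1, e2]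
    -- abbreviations
    set r := μ.real R with hr
    set rJ := μ.real (R ∩ (openConn o x ∪ openConn o y)) with hrJ
    set rB := μ.real (R ∩ openConn z b) with hrB
    set rJB := μ.real (R ∩ ((openConn o x ∪ openConn o y) ∩ openConn z b)) with hrJB
    set d := μ.real ((openConn y z)ᶜ : Set (BondConfig (Fin n))) with hd
    set dB := μ.real (((openConn y z)ᶜ : Set (BondConfig (Fin n))) ∩ openConn z b) with hdB
    set dZ := μ.real (((openConn y z)ᶜ : Set (BondConfig (Fin n))) ∩ openConn z o) with hdZ
    set dZB := μ.real (((openConn y z)ᶜ : Set (BondConfig (Fin n))) ∩ (openConn z o ∩ openConn z b)) with hdZB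
    set fD := μ.real ((openConn z b)ᶜ ∩ (openConn y z)ᶜ : Set (BondConfig (Fin n))) with hfD
    set rJF := μ.real ((R ∩ (openConn o x ∪ openConn o y)) \ openConn z b) with hrJF
    have hr0 : 0 ≤ r := measureReal_nonneg
    have hrJ0 : 0 ≤ rJ := measureReal_nonneg
    have hd0 : 0 ≤ d := measureReal_nonneg
    have hrJle : rJ ≤ r := by rw [hrJ, hr]; exact measureReal_mono inter_subset_left
    have hrJBle : rJB ≤ rJ := by
      rw [hrJB, hrJ]; exact measureReal_mono (inter_subset_inter_right _ inter_subset_left)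
    have hrJB0 : 0 ≤ rJB := measureReal_nonneg
    -- `r × (goal slack) ≥ rJ × (d·dZB − dZ·dB) ≥ 0`
    have hfD' : fD = d - dB := by linarith
    have hrJF' : rJF = rJ - rJB := by linarith
    have hr' : r = d - dZ := by linarith
    have hrB' : rB = dB - dZB := by linarith
    rw [hfD', hrJF']
    have key : r * (d * (rJ - rJB) - rJ * (d - dB)) ≥ 0 := by
      have h1 : d * (r * rJB) ≤ d * (rJ * rB) := mul_le_mul_of_nonneg_left h14 hd0
      have h2 : rJ * (dZ * dB) ≤ rJ * (d * dZB) := mul_le_mul_of_nonneg_left h13 hrJ0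
      rw [hrB'] at h1
      rw [hr']
      rw [hr'] at h1
      nlinarith [h1, h2]
    by_cases hrz : r = 0
    · have hrJz : rJ = 0 := le_antisymm (by rw [← hrz]; exact hrJle) hrJ0
      have hrJBz : rJB = 0 := le_antisymm (by rw [← hrJz]; exact hrJBle) hrJB0
      rw [hrJz, hrJBz]; simp
    · have hrpos : 0 < r := lt_of_le_of_ne hr0 (Ne.symm hrz)
      nlinarith [key, hrpos]

end

end Summit.CriticalPhenomena.PercolationContinuityZ3.Theorems
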